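import Literature.NumberTheory.Weil1965.ThetaIntegralOrbitFunctionalUnitary
import Literature.NumberTheory.Automorphic.AdelicVectorPlaceSplitting
import Literature.NumberTheory.Automorphic.UnitaryGroupPlaceInclusion
import Literature.NumberTheory.Automorphic.UnitaryGroupRestrictedProduct
import Literature.NumberTheory.Automorphic.QuadraticRestrictionOfScalars
import HarnessLib

/-!
# The geometric action of the unitary dual pair READ AT A FINITE PLACE `v`: `(A_h x)_v` is the local geometric
# action of `(h ⊗ 1)|_v` on `X□(F_v)` in the local quadratic coordinates

Topic `NumberTheory/Weil1965`; namespace `Literature.NumberTheory.Weil1965.UnitaryDoubling` (sequel of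
`ThetaIntegralOrbitFunctionalUnitary`: `toHermVec`, `vDiagAct`, `iotaV`).  KERNEL ONLY: theorems; no definition, no named fact,
no instance, no `sorry`.

Setting of ★ `ThetaIntegralOrbitFunctionalUnitary`: `E = F(δ)`, `c δ = -δ`, `δ² = d`, the dual pair `(U(J_V), U(J_W))` with `J_W` of
rank one, `X□(𝔸_F) = 𝔸_F^{n+n}`, the geometric action `A_h = vDiagAct h` (`h ∈ U(J_V)(𝔸_F)`), the Gram matrix
`𝕋 = adelicGram = 𝕋_F ⊗ 1` and the `𝔸_E`-coordinates `toHermVec`.  For a finite place `v` of `F` write `x_v := AdelicVector.evalAt F _ v x`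
(★ `AdelicVectorPlaceSplitting`), `𝕋_v := 𝕋_F.map (algebraMap F F_v)`, `Ψ_v := quadraticLocalEquiv E v c` (the local quadratic
coordinates `E ⊗ F_v = F_v ⊕ F_v δ`, ★ `isQuadraticCoordinates_local`), `z|_v := adeleToLocal E v ∘ z` for `z ∈ 𝔸_E^κ`.

* §1 the quadratic coordinates commute with the passage above `v`: `adeleToLocal_quadraticAdeleEquiv`
  (`Ψ_𝔸(a, b)|_v = Ψ_v(a_v, b_v)`, ★ `finiteAdeleToLocal_quadraticFiniteAdeleMap`), `re_adeleToLocal`, `im_adeleToLocal`, `evalAt_reIm`;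
* §2 the Gram matrix and the Darboux map at `v`: `map_adeleEval_adelicGram` (`𝕋|_v = 𝕋_v`), `map_adeleEval_adelicGram_inv`,
  `isUnit_det_gram_map_adicCompletion`, `evalAt_darboux`, `evalAt_darboux_symm`;
* §3 **`evalAt_vDiagAct_comp`** — for EVERY `h ∈ U(J_V)(𝔸_F)`:
  `(A_h x)_v ∘ e' = θ_{𝕋_v} (W_e (Res_v((h ⊗ 1)|_v) (W_e⁻¹ (θ_{𝕋_v}⁻¹ (x_v ∘ e')))))` (`e' = finSumFinEquiv`, `θ` the Darboux map,
  `W_e = reindexW`, `Res_v = (isQuadraticCoordinates_local …).resAut`): the `v`-component of the geometric action is the LOCAL geometric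
  action of `(h ⊗ 1)|_v ∈ GL_{N×1}(E ⊗ F_v)` — exactly the shape `A y` of `QuadraticHermitianNormSplitForm.exists_gl_split_intertwine`
  (★ `diagAct_apply_comp`, ★ `resAut_reIm` twice, `RingHom.map_mulVec` for `adeleToLocal`); and **`adeleToLocal_toHermVec`**:
  `(toHermVec x)|_v = reIm_v⁻¹ (W_e⁻¹ (θ_{𝕋_v}⁻¹ (x_v ∘ e')))` (the local `𝔸_E`-coordinates depend only on `x_v`);
* §4 `map_adeleToLocal_adelicInl_mem` (`(h ⊗ 1)|_v` lies in the local unitary group of `(J_V ⊗ J_W)|_v`) and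
  **`map_adeleToLocal_adelicVal_inclPlaceAdelic`**: for the `v`-supported element `ι_v u = inclPlaceAdelic v u` of the tree,
  `(ι_v u)|_v = u` in `GL_N(E ⊗ F_v)` (★ `evalAt_inclPlace_of_over`, ★ `localPiEquiv`).

This is the «read at `v`» half of Weil's step `X_A = X_v × X′` for the `v`-member of the dual pair (A. Weil, *Acta Math.* 113
(1965), Chap. V n° 50, pp. 73–74); with `ThetaIntegralGeometricActionLocal` (the `v`-member fixes `X′`) and the split-place
coordinates `β_v` (`QuadraticHermitianNormSplitForm`, `ThetaIntegralHermNormSplit`) it yields the intertwining clause of the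
binder (SPLIT-v ∘ BRIDGE-v) of the I-CLOSE assembly.

## References
* [Weil1965] A. Weil, *Sur la formule de Siegel dans la théorie des groupes classiques*, Acta Math. 113 (1965), Chap. V n° 50,
  pp. 73–74.
* [GelbartRogawski1991] S. Gelbart, J. Rogawski, Invent. Math. 105 (1991), §3.1 p. 454 (coordinates of the dual pair), §3.2 p. 457.
* [CasselsFrohlichANT1967] J. W. S. Cassels, A. Fröhlich, *Algebraic Number Theory* (1967), Ch. II §14.
* [PlatonovRapinchuk1994] V. Platonov, A. Rapinchuk, *Algebraic Groups and Number Theory* (1994), §5.1.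

USE (cell `hodgecm-mathlib`, FLOOR-0 P4, ENGINE E-2, `StubSW2` (iii), outer assembly binder (SPLIT-v ∘ BRIDGE-v)).  HC_CM is proved only
modulo the printed citations until rung 0 closes.
-/

set_option autoImplicit false

noncomputable section

namespace Literature.NumberTheory.Weil1965.UnitaryDoubling

open scoped Matrix Kronecker
open _root_.MeasureTheory NumberField IsDedekindDomain
open Literature.RepresentationTheory.HeisenbergGroup
open Literature.RepresentationTheory.HeisenbergGroup.SymplecticMatrix
open Literature.NumberTheory.Weil1964 Literature.NumberTheory.Weil1965 Literature.NumberTheory.Automorphic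
open Literature.NumberTheory.GelbartRogawski1991 Literature.NumberTheory.GelbartRogawski1991.UnitaryDualPair
open Literature.NumberTheory.Automorphic.UnitaryGroup (reindexW reindexW_apply reindexW_symm_apply quadraticAdeleEquiv
  quadraticAdeleEquiv_apply quadraticAdeleMap_snd quadraticLocalEquiv quadraticLocalEquiv_apply quadraticLocalMap_apply
  adelicVal adelicVal_finAdelicToAdelic map_snd_ofFinite adeleSnd PlacesOver LocalRing localPi «local» localPiEquiv
  localGLPiEquiv coe_localPiEquiv_apply inclPlace inclPlaceAdelic inclPlaceAdelic_apply evalAt_inclPlace_of_over adeleToLocal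
  adeleToLocal_apply adeleToLocal_conj conjLocal conjAdele toLocalRing finiteAdeleToLocal finiteAdeleToLocal_quadraticFiniteAdeleMap
  isQuadraticCoordinates_adele isQuadraticCoordinates_local adelicForm adelicInl adelicPair coe_adelicInl)
open Literature.NumberTheory.Automorphic.UnitaryGroup.QuadraticCoordinates
open Literature.NumberTheory.Automorphic.AdelicVector (evalAt evalAt_apply evalAt_mulVec)

section AtPlace

variable (F E : Type) [Field F] [NumberField F] [Field E] [NumberField E] [Algebra F E] [Algebra.IsQuadraticExtension F E]
  (c : E ≃ₐ[F] E) {δ : E} (hcδ : c δ = -δ) (hδ : δ ≠ 0) {d : F} (hd : δ * δ = algebraMap F E d)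
  (N : ℕ) {n : ℕ} (e : Fin N × Fin 1 ≃ Fin n)
  (TV : Matrix (Fin N) (Fin N) F) (hV : TV.IsSymm) (hVd : IsUnit TV.det)
  (TW : Matrix (Fin 1) (Fin 1) F) (hW : TW.IsSymm) (hWd : IsUnit TW.det)
  (v : HeightOneSpectrum (𝓞 F))

/-! ## §1 The quadratic coordinates commute with the passage to the places above `v` -/

omit [NumberField F] [Algebra.IsQuadraticExtension F E] in
/-- `adeleToLocal E v z` is the finite part of `z` read above `v` (definitional). [folklore] -/
private theorem adeleToLocal_eq_finiteAdeleToLocal (z : AdeleRing (𝓞 E) E) :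
    adeleToLocal E v z = finiteAdeleToLocal E v z.2 := rfl

/-- **`Ψ_𝔸` read above `v` is `Ψ_v` at the `v`-components**: `(Ψ_𝔸(a, b))|_{w ∣ v} = Ψ_v(a_v, b_v)`
(★ `finiteAdeleToLocal_quadraticFiniteAdeleMap`). [cite: CasselsFrohlichANT1967, Ch. II §14] -/
theorem adeleToLocal_quadraticAdeleEquiv (p : AdeleRing (𝓞 F) F × AdeleRing (𝓞 F) F) :
    adeleToLocal E v (quadraticAdeleEquiv F E c hcδ hδ p) =
      quadraticLocalEquiv E v c hcδ hδ (AdelicGroupData.adeleEval F v p.1, AdelicGroupData.adeleEval F v p.2) := by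
  rw [adeleToLocal_eq_finiteAdeleToLocal, quadraticLocalEquiv_apply, ← quadraticLocalMap_apply]
  rw [quadraticAdeleEquiv_apply, ← Literature.NumberTheory.Automorphic.UnitaryGroup.quadraticAdeleMap_apply, quadraticAdeleMap_snd,
    finiteAdeleToLocal_quadraticFiniteAdeleMap]
  rfl

/-- **`re` commutes with the passage above `v`**: `re_v (z|_{w ∣ v}) = (re_𝔸 z)_v`. [cite: CasselsFrohlichANT1967, Ch. II §14] -/
theorem re_adeleToLocal (z : AdeleRing (𝓞 E) E) :
    re (quadraticLocalEquiv E v c hcδ hδ).toLinearEquiv.toAddEquiv (adeleToLocal E v z) =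
      AdelicGroupData.adeleEval F v (re (quadraticAdeleEquiv F E c hcδ hδ).toAddEquiv z) := by
  conv_lhs => rw [← apply_re_im (quadraticAdeleEquiv F E c hcδ hδ).toAddEquiv z]
  change re (quadraticLocalEquiv E v c hcδ hδ).toLinearEquiv.toAddEquiv (adeleToLocal E v (quadraticAdeleEquiv F E c hcδ hδ _)) = _
  rw [adeleToLocal_quadraticAdeleEquiv]
  exact re_apply (quadraticLocalEquiv E v c hcδ hδ).toLinearEquiv.toAddEquiv _ _

/-- **`im` commutes with the passage above `v`**: `im_v (z|_{w ∣ v}) = (im_𝔸 z)_v`. [cite: CasselsFrohlichANT1967, Ch. II §14] -/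
theorem im_adeleToLocal (z : AdeleRing (𝓞 E) E) :
    im (quadraticLocalEquiv E v c hcδ hδ).toLinearEquiv.toAddEquiv (adeleToLocal E v z) =
      AdelicGroupData.adeleEval F v (im (quadraticAdeleEquiv F E c hcδ hδ).toAddEquiv z) := by
  conv_lhs => rw [← apply_re_im (quadraticAdeleEquiv F E c hcδ hδ).toAddEquiv z]
  change im (quadraticLocalEquiv E v c hcδ hδ).toLinearEquiv.toAddEquiv (adeleToLocal E v (quadraticAdeleEquiv F E c hcδ hδ _)) = _
  rw [adeleToLocal_quadraticAdeleEquiv]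
  exact im_apply (quadraticLocalEquiv E v c hcδ hδ).toLinearEquiv.toAddEquiv _ _

/-- **`reIm` commutes with the passage above `v`** (vectors): `(reIm_𝔸 y)_v = reIm_v (y|_{w ∣ v})` componentwise.
[cite: CasselsFrohlichANT1967, Ch. II §14] -/
theorem evalAt_reIm {κ : Type} (y : κ → AdeleRing (𝓞 E) E) :
    (evalAt F κ v (reIm (quadraticAdeleEquiv F E c hcδ hδ).toAddEquiv κ y).1,
      evalAt F κ v (reIm (quadraticAdeleEquiv F E c hcδ hδ).toAddEquiv κ y).2) =
      reIm (quadraticLocalEquiv E v c hcδ hδ).toLinearEquiv.toAddEquiv κ (fun p => adeleToLocal E v (y p)) := by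
  refine Prod.ext (funext fun p => ?_) (funext fun p => ?_)
  · rw [reIm_apply_fst]
    exact (re_adeleToLocal F E c hcδ hδ v (y p)).symm
  · rw [reIm_apply_snd]
    exact (im_adeleToLocal F E c hcδ hδ v (y p)).symm

/-! ## §2 The Gram matrix and the Darboux map at `v` -/

omit [Algebra.IsQuadraticExtension F E] in
/-- a principal adele read at `v` (definitional). [folklore] -/
private theorem adeleEval_algebraMap (x : F) :
    AdelicGroupData.adeleEval F v (algebraMap F (AdeleRing (𝓞 F) F) x) = (x : v.adicCompletion F) := rfl

/-- **`𝕋` read at `v` is `𝕋_v := 𝕋_F ⊗ 1_{F_v}`**. [cite: GelbartRogawski1991, §3.1 p. 454] -/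
theorem map_adeleEval_adelicGram :
    (adelicGram F e TV TW).map (AdelicGroupData.adeleEval F v) = (gram F e TV TW).map (algebraMap F (v.adicCompletion F)) := by
  rw [adelicGram_eq_map, Matrix.map_map]
  rfl

include hVd hWd in
/-- `𝕋⁻¹` read at `v` is `𝕋_v⁻¹`. [cite: GelbartRogawski1991, §3.1 p. 454] -/
theorem map_adeleEval_adelicGram_inv :
    (adelicGram F e TV TW)⁻¹.map (AdelicGroupData.adeleEval F v) =
      ((gram F e TV TW).map (algebraMap F (v.adicCompletion F)))⁻¹ := by
  have hT : IsUnit (adelicGram F e TV TW).det := isUnit_det_adelicGram F e hVd hWd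
  refine (Matrix.inv_eq_left_inv ?_).symm
  rw [← map_adeleEval_adelicGram F N e TV TW v, ← Matrix.map_mul, Matrix.nonsing_inv_mul _ hT,
    Matrix.map_one _ (map_zero _) (map_one _)]

include hVd hWd in
/-- `𝕋_v` is invertible. [cite: GelbartRogawski1991, §3.1 p. 454] -/
theorem isUnit_det_gram_map_adicCompletion : IsUnit ((gram F e TV TW).map (algebraMap F (v.adicCompletion F))).det := by
  rw [← map_adeleEval_adelicGram F N e TV TW v, ← RingHom.mapMatrix_apply, ← RingHom.map_det]
  exact (isUnit_det_adelicGram F e hVd hWd).map _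

/-- **The Darboux map read at `v`**: `(θ_𝕋 (a, b))_v = θ_{𝕋_v} (a_v, b_v)`. [cite: Weil1965, Chap. V n° 50, pp. 73–74] -/
theorem evalAt_darboux (p : (Fin n → AdeleRing (𝓞 F) F) × (Fin n → AdeleRing (𝓞 F) F)) :
    evalAt F (Fin n ⊕ Fin n) v (darboux (adelicGram F e TV TW) (isUnit_det_adelicGram F e hVd hWd) p) =
      darboux ((gram F e TV TW).map (algebraMap F (v.adicCompletion F))) (isUnit_det_gram_map_adicCompletion F N e TV hVd TW hWd v)
        (evalAt F (Fin n) v p.1, evalAt F (Fin n) v p.2) := by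
  rw [darboux_apply, darboux_apply]
  funext i
  rcases i with i | i
  · rfl
  · change AdelicGroupData.adeleEval F v ((adelicGram F e TV TW *ᵥ p.2) i) = _
    rw [Sum.elim_inr, RingHom.map_mulVec, map_adeleEval_adelicGram]
    rfl

/-- **The inverse Darboux map read at `v`**. [cite: Weil1965, Chap. V n° 50, pp. 73–74] -/
theorem evalAt_darboux_symm (u : Fin n ⊕ Fin n → AdeleRing (𝓞 F) F) :
    (evalAt F (Fin n) v ((darboux (adelicGram F e TV TW) (isUnit_det_adelicGram F e hVd hWd)).symm u).1,
      evalAt F (Fin n) v ((darboux (adelicGram F e TV TW) (isUnit_det_adelicGram F e hVd hWd)).symm u).2) =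
      (darboux ((gram F e TV TW).map (algebraMap F (v.adicCompletion F)))
        (isUnit_det_gram_map_adicCompletion F N e TV hVd TW hWd v)).symm (evalAt F (Fin n ⊕ Fin n) v u) := by
  rw [darboux_symm_apply, darboux_symm_apply]
  refine Prod.ext rfl ?_
  change evalAt F (Fin n) v ((adelicGram F e TV TW)⁻¹ *ᵥ (u ∘ Sum.inr)) = _
  rw [evalAt_mulVec, map_adeleEval_adelicGram_inv F N e TV hVd TW hWd v]
  rfl

/-! ## §3 The geometric action read at `v` -/

/-- **The geometric action of `h ∈ U(J_V)(𝔸_F)` read at `v`**: the `v`-components of `A_h x` are obtained from the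
`v`-components of `x` by the LOCAL geometric action of the image `h_v ⊗ 1` of `h ⊗ 1` in `GL_{N×1}(E ⊗ F_v)` in the local
quadratic coordinates — `(A_h x)_v ∘ e' = θ_{𝕋_v} (W_e (Res_v(h_v ⊗ 1) (W_e⁻¹ (θ_{𝕋_v}⁻¹ (x_v ∘ e')))))`, the shape `A y` of
`QuadraticHermitianNormSplitForm.exists_gl_split_intertwine` (Weil (1965) n° 50: the `v`-member acts on `X_v`).
[cite: Weil1965, Chap. V n° 50, pp. 73–74] -/
theorem evalAt_vDiagAct_comp (h : UnitaryGroup.adelic F E c N (TV.map (algebraMap F E))) (x : Fin (n + n) → AdeleRing (𝓞 F) F) :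
    (evalAt F (Fin (n + n)) v (vDiagAct F E c hcδ hδ hd N e TV hV hVd TW hW hWd h x)) ∘ ⇑finSumFinEquiv =
      darboux ((gram F e TV TW).map (algebraMap F (v.adicCompletion F))) (isUnit_det_gram_map_adicCompletion F N e TV hVd TW hWd v)
        (reindexW (v.adicCompletion F) e
          ((isQuadraticCoordinates_local E v c hcδ hδ hd).resAut (Fin N × Fin 1)
            (Matrix.GeneralLinearGroup.map (adeleToLocal E v)
              ((adelicInl F E c N 1 (TV.map (algebraMap F E)) (TW.map (algebraMap F E)) h :
                adelicPair F E c N 1 (TV.map (algebraMap F E)) (TW.map (algebraMap F E))) :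
                  GL (Fin N × Fin 1) (AdeleRing (𝓞 E) E)))
            ((reindexW (v.adicCompletion F) e).symm
              ((darboux ((gram F e TV TW).map (algebraMap F (v.adicCompletion F)))
                  (isUnit_det_gram_map_adicCompletion F N e TV hVd TW hWd v)).symm
                ((evalAt F (Fin (n + n)) v x) ∘ ⇑finSumFinEquiv))))) := by
  -- abbreviations
  set Ψ := (quadraticAdeleEquiv F E c hcδ hδ).toAddEquiv with hΨ
  set Ψv := (quadraticLocalEquiv E v c hcδ hδ).toLinearEquiv.toAddEquiv with hΨv
  set G : GL (Fin N × Fin 1) (AdeleRing (𝓞 E) E) :=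
    ((adelicInl F E c N 1 (TV.map (algebraMap F E)) (TW.map (algebraMap F E)) h :
      adelicPair F E c N 1 (TV.map (algebraMap F E)) (TW.map (algebraMap F E))) : GL (Fin N × Fin 1) (AdeleRing (𝓞 E) E)) with hG
  set z := toHermVec F E c hcδ hδ N e TV hVd TW hWd x with hz
  -- the adelic side: `A_h x ∘ e' = θ (W_e (reIm (G z)))` (★ `diagAct_apply_comp`, `resAut_reIm`)
  have hre : (reindexW (AdeleRing (𝓞 F) F) e).symm
      ((darboux (adelicGram F e TV TW) (isUnit_det_adelicGram F e hVd hWd)).symm (x ∘ ⇑finSumFinEquiv)) = reIm Ψ (Fin N × Fin 1) z := by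
    rw [hz, toHermVec, AddEquiv.apply_symm_apply]
  have h1 : (vDiagAct F E c hcδ hδ hd N e TV hV hVd TW hW hWd h x) ∘ ⇑finSumFinEquiv =
      darboux (adelicGram F e TV TW) (isUnit_det_adelicGram F e hVd hWd)
        (reindexW (AdeleRing (𝓞 F) F) e (reIm Ψ (Fin N × Fin 1) ((G : Matrix _ _ (AdeleRing (𝓞 E) E)) *ᵥ z))) := by
    have h2 : ∀ w : ((Fin n → AdeleRing (𝓞 F) F) × (Fin n → AdeleRing (𝓞 F) F)),
        (((iotaV F E c hcδ hδ hd N e TV hV TW hW) h : symplecticGroup (polar (adelicForm F (Fin n) (adelicGram F e TV TW)))) :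
          ((Fin n → AdeleRing (𝓞 F) F) × (Fin n → AdeleRing (𝓞 F) F)) ≃ₗ[AdeleRing (𝓞 F) F]
            ((Fin n → AdeleRing (𝓞 F) F) × (Fin n → AdeleRing (𝓞 F) F))) w =
        reindexW (AdeleRing (𝓞 F) F) e ((isQuadraticCoordinates_adele E c hcδ hδ hd).resAut (Fin N × Fin 1) G
          ((reindexW (AdeleRing (𝓞 F) F) e).symm w)) := fun w => rfl
    rw [vDiagAct_apply, diagAct_apply_comp, h2, hre, (isQuadraticCoordinates_adele E c hcδ hδ hd).resAut_reIm]
  -- read at `v`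
  have h3 : (evalAt F (Fin (n + n)) v (vDiagAct F E c hcδ hδ hd N e TV hV hVd TW hW hWd h x)) ∘ ⇑finSumFinEquiv =
      evalAt F (Fin n ⊕ Fin n) v ((vDiagAct F E c hcδ hδ hd N e TV hV hVd TW hW hWd h x) ∘ ⇑finSumFinEquiv) := rfl
  rw [h3, h1, evalAt_darboux F N e TV hVd TW hWd v]
  congr 1
  -- `(W_e q)_v = W_e (q_v)` and `(reIm_𝔸 (G z))_v = reIm_v ((G z)_v) = reIm_v (G_v z_v) = Res_v G_v (reIm_v z_v)`
  rw [reindexW_apply, reindexW_apply]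
  have h4 : (evalAt F (Fin N × Fin 1) v (reIm Ψ (Fin N × Fin 1) ((G : Matrix _ _ (AdeleRing (𝓞 E) E)) *ᵥ z)).1,
      evalAt F (Fin N × Fin 1) v (reIm Ψ (Fin N × Fin 1) ((G : Matrix _ _ (AdeleRing (𝓞 E) E)) *ᵥ z)).2) =
      (isQuadraticCoordinates_local E v c hcδ hδ hd).resAut (Fin N × Fin 1) (Matrix.GeneralLinearGroup.map (adeleToLocal E v) G)
        (reIm Ψv (Fin N × Fin 1) (fun p => adeleToLocal E v (z p))) := by
    rw [hΨ, evalAt_reIm F E c hcδ hδ v, (isQuadraticCoordinates_local E v c hcδ hδ hd).resAut_reIm]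
    congr 1
    funext p
    rw [RingHom.map_mulVec]
    rfl
  have h5 : reIm Ψv (Fin N × Fin 1) (fun p => adeleToLocal E v (z p)) =
      (reindexW (v.adicCompletion F) e).symm
        ((darboux ((gram F e TV TW).map (algebraMap F (v.adicCompletion F)))
            (isUnit_det_gram_map_adicCompletion F N e TV hVd TW hWd v)).symm ((evalAt F (Fin (n + n)) v x) ∘ ⇑finSumFinEquiv)) := by
    have hcomp : (evalAt F (Fin (n + n)) v x) ∘ ⇑finSumFinEquiv = evalAt F (Fin n ⊕ Fin n) v (x ∘ ⇑finSumFinEquiv) := rfl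
    rw [hΨv, ← evalAt_reIm F E c hcδ hδ v, ← hΨ, ← hre, reindexW_symm_apply, reindexW_symm_apply, hcomp,
      ← evalAt_darboux_symm F N e TV hVd TW hWd v]
    rfl
  have h41 := congrArg Prod.fst h4
  have h42 := congrArg Prod.snd h4
  simp only at h41 h42
  refine Prod.ext ?_ ?_
  · change (evalAt F (Fin N × Fin 1) v (reIm Ψ (Fin N × Fin 1) ((G : Matrix _ _ (AdeleRing (𝓞 E) E)) *ᵥ z)).1) ∘ ⇑e.symm = _
    rw [h41, h5]
  · change (evalAt F (Fin N × Fin 1) v (reIm Ψ (Fin N × Fin 1) ((G : Matrix _ _ (AdeleRing (𝓞 E) E)) *ᵥ z)).2) ∘ ⇑e.symm = _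
    rw [h42, h5]

/-- **`toHermVec` read above `v`**: `(toHermVec x)|_{w ∣ v} = reIm_v⁻¹ (W_e⁻¹ (θ_{𝕋_v}⁻¹ (x_v ∘ e')))` — the LOCAL `𝔸_E`-coordinates
depend only on the `v`-components. [cite: GelbartRogawski1991, §3.1 p. 454] -/
theorem adeleToLocal_toHermVec (x : Fin (n + n) → AdeleRing (𝓞 F) F) :
    (fun p => adeleToLocal E v (toHermVec F E c hcδ hδ N e TV hVd TW hWd x p)) =
      (reIm (quadraticLocalEquiv E v c hcδ hδ).toLinearEquiv.toAddEquiv (Fin N × Fin 1)).symm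
        ((reindexW (v.adicCompletion F) e).symm
          ((darboux ((gram F e TV TW).map (algebraMap F (v.adicCompletion F)))
              (isUnit_det_gram_map_adicCompletion F N e TV hVd TW hWd v)).symm ((evalAt F (Fin (n + n)) v x) ∘ ⇑finSumFinEquiv))) := by
  apply (reIm (quadraticLocalEquiv E v c hcδ hδ).toLinearEquiv.toAddEquiv (Fin N × Fin 1)).injective
  rw [AddEquiv.apply_symm_apply, ← evalAt_reIm F E c hcδ hδ v]
  have hre : reIm (quadraticAdeleEquiv F E c hcδ hδ).toAddEquiv (Fin N × Fin 1) (toHermVec F E c hcδ hδ N e TV hVd TW hWd x) =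
      (reindexW (AdeleRing (𝓞 F) F) e).symm
        ((darboux (adelicGram F e TV TW) (isUnit_det_adelicGram F e hVd hWd)).symm (x ∘ ⇑finSumFinEquiv)) := by
    rw [toHermVec, AddEquiv.apply_symm_apply]
  have hcomp : (evalAt F (Fin (n + n)) v x) ∘ ⇑finSumFinEquiv = evalAt F (Fin n ⊕ Fin n) v (x ∘ ⇑finSumFinEquiv) := rfl
  rw [hre, reindexW_symm_apply, reindexW_symm_apply, hcomp, ← evalAt_darboux_symm F N e TV hVd TW hWd v]
  rfl

/-! ## §4 The local image of a `v`-supported element; membership -/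

omit [Algebra.IsQuadraticExtension F E] in
/-- **The image of `h ⊗ 1` above `v` lies in the local unitary group of `(J_V ⊗ J_W) ⊗ 1`.** [cite: GelbartRogawski1991, §3.2 p. 457] -/
theorem map_adeleToLocal_adelicInl_mem (h : UnitaryGroup.adelic F E c N (TV.map (algebraMap F E))) :
    Matrix.GeneralLinearGroup.map (adeleToLocal E v)
        ((adelicInl F E c N 1 (TV.map (algebraMap F E)) (TW.map (algebraMap F E)) h :
          adelicPair F E c N 1 (TV.map (algebraMap F E)) (TW.map (algebraMap F E))) : GL (Fin N × Fin 1) (AdeleRing (𝓞 E) E)) ∈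
      unitaryGroupOfForm (conjLocal E c v)
        ((adelicForm E N (TV.map (algebraMap F E)) ⊗ₖ adelicForm E 1 (TW.map (algebraMap F E))).map (adeleToLocal E v)) :=
  map_mem_unitaryGroupOfForm (adeleToLocal E v) (adeleToLocal_conj E c v)
    (adelicInl F E c N 1 (TV.map (algebraMap F E)) (TW.map (algebraMap F E)) h).2

omit [Algebra.IsQuadraticExtension F E] in
/-- **A `v`-supported element read above `v` is its local datum**: `(ι_v u)|_{w ∣ v} = u` as an element of `GL_N(E ⊗ F_v)`
(★ `evalAt_inclPlace_of_over`, ★ `localPiEquiv`). [cite: PlatonovRapinchuk1994, §5.1] -/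
theorem map_adeleToLocal_adelicVal_inclPlaceAdelic (J : Matrix (Fin N) (Fin N) E) (u : localPi E c N J v) :
    Matrix.GeneralLinearGroup.map (adeleToLocal E v) (adelicVal F E c N J (inclPlaceAdelic F E c N J v u)) =
      ((localPiEquiv E c N J v u : «local» E c N J v) : GL (Fin N) (LocalRing E v)) := by
  refine Matrix.GeneralLinearGroup.ext fun i j => funext fun w => ?_
  rw [coe_localPiEquiv_apply]
  change adeleToLocal E v ((adelicVal F E c N J (inclPlaceAdelic F E c N J v u)).val i j) w =
    (((localGLPiEquiv E N v).symm u.1 : GL (Fin N) (LocalRing E v)) : Matrix (Fin N) (Fin N) (LocalRing E v)) i j w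
  rw [GLn.coe_piEquiv_symm_apply, adeleToLocal_apply, inclPlaceAdelic_apply, adelicVal_finAdelicToAdelic]
  have hsnd := map_snd_ofFinite E N (inclPlace F E c N J v u).1
  have hij : ((GLn.ofFinite N E (inclPlace F E c N J v u).1).val i j).2 = (inclPlace F E c N J v u).1.val i j := by
    have := congrFun (congrFun hsnd i) j
    rwa [Matrix.map_apply] at this
  have hw := evalAt_inclPlace_of_over F E c N J v u w
  have hw' := congrArg (fun g : GL (Fin N) (w.1.adicCompletion E) => (g : Matrix (Fin N) (Fin N) (w.1.adicCompletion E)) i j) hw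
  change ((GLn.ofFinite N E (inclPlace F E c N J v u).1).val i j).2 w.1 = _
  rw [hij, ← hw']
  rfl

end AtPlace

end Literature.NumberTheory.Weil1965.UnitaryDoubling
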